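import Summits.QuantumFields.YangMills.Theorems.BalabanLadderNTClassicalShadowOrbitSoftSwap
import HarnessLib

/-!
# Crux `NT` (stmt-QuantumFields-19353), stub `stub_refpkgT : RefPkgT`: THE CLASSICAL SHADOW, XVIII — WEIGHT-FREE orbit floors: clause 2 priced by
# the orbit statistics of EACH ground state separately — no one-orbit premise, no reference configuration, no energy gap

Helper file (`--supports stmt-QuantumFields-19353`) of the fleet lead prover of crux `NT` (unit `ym-spine-19353-p1`, GEN 16); sequel of
`…ClassicalShadowOrbitSoft{,Closure,Swap}` (this generation).

WHY.  Every orbit test in the tree (exact, g14/g15; δ-robust, this generation) needs the ground-state set of the frustrated box to be (close to) ONE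
`Γ`-orbit, and this generation's kit (SIZING-19353-g16 §2) shows that premise to be protected only by a classical energy gap that collapses with the box size
(`ΔS = 0.009` at `b = 6`), in a glassy landscape of 40–50 distinct symmetry-broken minima per 50 starts — while EVERY minimum found carries boundary-layer
long-range order of the same size.  The honest variational input is therefore a statement about EACH ground state separately, with no control of how the
zero-temperature law weighs different orbits.  This file proves that such weight-free statements still price clause 2, via the shifted products
`G_t = (dens_x − t)(dens_y − t)`: the `Γ`-average of `G_t` on a configuration `U` is `Cov_Γ(U; x, y) + (a_U − t)(b_U − t)` (`a_U, b_U` the orbit means of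
`dens_x, dens_y` on the orbit of `U`), the kernel mean of `G_t` is that of its `Γ`-average (kernel symmetry), and `kerCov = kerE(G_t) − (m_x − t)(m_y − t)`:

* §1 algebra: `sum_shifted_mul`, `kerE_shiftedMul_eq`, `kerE_eq_kerE_orbitSum_div`;
* §2 **`eventually_kerCov_le_of_orbitCov_le`** (NEGATIVE floors, no net): if on every ground state the orbit covariance is `≤ −c₀` and both orbit means are
  within `ρ` of a common value `t₀`, then eventually `kerCov^η_β(dens_x, dens_y) ≤ −c₀ + 2ρ² + ε`;
* §3 **`eventually_kerCov_ge_of_orbitCov_ge`** (POSITIVE floors, a finite net in `t`): if on every ground state the orbit covariance is `≥ c₀` and the two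
  orbit means differ by at most `μ`, then eventually `kerCov^η_β(dens_x, dens_y) ≥ c₀ − μ²/4 − ε` — whatever the weights of the orbits;
* the prices (clause 2 ⇒ `c₀ − 2ρ² ≤ C₂/…`, `c₀ − μ²/4 ≤ C₂/…`), the kill-path feed and the fully discharged swap instance
  («every ground state has swap contrast `≥ Δ` and mean within `ρ` of a common value» ⇒ `Δ²/4 − 2ρ² ≤ C₂/…`) are in the companion file
  `…ClassicalShadowOrbitFloorWeightFreePrice`.

HONEST FRAMING.  Consequences of the registered clause at fixed lattice geometry as `β → ∞`; the ground-state statistics are HYPOTHESES (checkable on found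
minima, certifiable in principle on sublevel sets); nothing here asserts that such boxes exist; no floor, not AF, not NT, not the seam, not the gap; not Clay.
-/

set_option autoImplicit false

noncomputable section

open MeasureTheory Filter Topology
open Literature.MathematicalPhysics.QuantumFieldTheory Literature.MathematicalPhysics.QuantumLattice
open Literature.Probability.LatticeModels
open Summit.QuantumFields.YangMills.Cruxes.OSLegsFromFemtoAndGap.DlrCollarTransfer
open Summit.QuantumFields.YangMills.Cruxes.UVSeamRec.BoundaryLawPenetration
open Summit.QuantumFields.YangMills.Theorems.OSLegsFromFemtoAndGap.StubLower (integrable_of_continuous_compact)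

namespace Summit.QuantumFields.YangMills.Cruxes.NT.ClassicalShadow

variable {G : Type} [Group G] [TopologicalSpace G] [IsTopologicalGroup G] [CompactSpace G]
  [MeasurableSpace G] [BorelSpace G] (r : LatticeRep G)

/-! ## §1 Algebra of the shifted products -/

section Algebra

variable {ι : Type} [Fintype ι]

omit [Group G] [TopologicalSpace G] [IsTopologicalGroup G] [CompactSpace G] [MeasurableSpace G] [BorelSpace G] in
/-- `Σᵢ (fᵢ − t)(gᵢ − t) = Σᵢ fᵢgᵢ − t(Σᵢ fᵢ + Σᵢ gᵢ) + k·t²`. [folklore] -/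
theorem sum_shifted_mul (f g : ι → ℝ) (t : ℝ) :
    ∑ i, (f i - t) * (g i - t) = ∑ i, f i * g i - t * (∑ i, f i + ∑ i, g i) + Fintype.card ι * t ^ 2 := by
  have e : ∀ i, (f i - t) * (g i - t) = f i * g i - (t * f i + t * g i) + t ^ 2 := fun i => by ring
  simp_rw [e]
  rw [Finset.sum_add_distrib, Finset.sum_sub_distrib, Finset.sum_add_distrib, ← Finset.mul_sum, ← Finset.mul_sum, Finset.sum_const,
    Finset.card_univ, nsmul_eq_mul]
  ring

omit [Group G] [TopologicalSpace G] [IsTopologicalGroup G] [CompactSpace G] [MeasurableSpace G] [BorelSpace G] in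
/-- The orbit average of the shifted product is the orbit covariance plus the product of the shifted orbit means:
`(1/k)Σᵢ(fᵢ − t)(gᵢ − t) = [ (1/k)Σfᵢgᵢ − ((1/k)Σfᵢ)((1/k)Σgᵢ) ] + ((1/k)Σfᵢ − t)((1/k)Σgᵢ − t)`. [folklore] -/
theorem orbitAvg_shifted_mul [Nonempty ι] (f g : ι → ℝ) (t : ℝ) :
    (∑ i, (f i - t) * (g i - t)) / Fintype.card ι =
      ((∑ i, f i * g i) / Fintype.card ι - (∑ i, f i) / Fintype.card ι * ((∑ i, g i) / Fintype.card ι)) +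
        ((∑ i, f i) / Fintype.card ι - t) * ((∑ i, g i) / Fintype.card ι - t) := by
  have hk : (Fintype.card ι : ℝ) ≠ 0 := (Nat.cast_pos.2 Fintype.card_pos).ne'
  rw [sum_shifted_mul]
  field_simp
  ring

omit [Group G] [TopologicalSpace G] [IsTopologicalGroup G] [CompactSpace G] [MeasurableSpace G] [BorelSpace G] in
/-- `|S/k − t| ≤ ρ ⇒ |S − k·t| ≤ k·ρ` (`k > 0`). [folklore] -/
theorem abs_sub_mul_le_of_abs_div_sub_le {S t ρ k : ℝ} (hk : 0 < k) (h : |S / k - t| ≤ ρ) : |S - k * t| ≤ k * ρ := by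
  have e : S - k * t = k * (S / k - t) := by field_simp
  rw [e, abs_mul, abs_of_pos hk]
  exact mul_le_mul_of_nonneg_left h hk.le

variable (c : Fin 4 → ℤ) (b : ℕ) (η : LGConfig 4 G)

/-- **The kernel mean of a shifted product**: `kerE((dens_x − t)(dens_y − t)) = kerE(dens_x dens_y) − t·kerE(dens_x) − t·kerE(dens_y) + t²`. [folklore] -/
theorem kerE_shiftedMul_eq (β : ℝ) (x y : Fin 4 → ℤ) (t : ℝ) :
    kerE G r β c b η (fun U => (dens G r x U - t) * (dens G r y U - t)) =
      kerE G r β c b η (fun U => dens G r x U * dens G r y U) - t * kerE G r β c b η (dens G r x) - t * kerE G r β c b η (dens G r y) + t ^ 2 := by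
  haveI : SecondCountableTopology G := (Continuous.isClosedEmbedding r.continuous r.injective).isEmbedding.secondCountableTopology
  haveI := isProbabilityMeasure_ymSpecification r.ρ r.continuous β (cubeEdges c b) η
  have hX : Integrable (fun U => dens G r x U) (ymSpecification (d := 4) r.ρ β (cubeEdges c b) η) :=
    integrable_of_continuous_compact (continuous_dens r x)
  have hY : Integrable (fun U => dens G r y U) (ymSpecification (d := 4) r.ρ β (cubeEdges c b) η) :=
    integrable_of_continuous_compact (continuous_dens r y)
  have hXY : Integrable (fun U => dens G r x U * dens G r y U) (ymSpecification (d := 4) r.ρ β (cubeEdges c b) η) :=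
    integrable_of_continuous_compact ((continuous_dens r x).mul (continuous_dens r y))
  have i2 : Integrable (fun U => t * dens G r x U) (ymSpecification (d := 4) r.ρ β (cubeEdges c b) η) := hX.const_mul t
  have i3 : Integrable (fun U => t * dens G r y U) (ymSpecification (d := 4) r.ρ β (cubeEdges c b) η) := hY.const_mul t
  have i12 : Integrable (fun U => dens G r x U * dens G r y U - t * dens G r x U) (ymSpecification (d := 4) r.ρ β (cubeEdges c b) η) :=
    hXY.sub i2
  have i123 : Integrable (fun U => dens G r x U * dens G r y U - t * dens G r x U - t * dens G r y U)
      (ymSpecification (d := 4) r.ρ β (cubeEdges c b) η) := i12.sub i3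
  have e : (fun U => (dens G r x U - t) * (dens G r y U - t)) =
      fun U => dens G r x U * dens G r y U - t * dens G r x U - t * dens G r y U + t ^ 2 := by
    funext U; ring
  unfold kerE
  rw [e, integral_add i123 (integrable_const _), integral_sub i12 i3, integral_sub hXY i2, integral_const_mul, integral_const_mul,
    integral_const]
  simp only [probReal_univ, one_smul]

variable [Nonempty ι]

/-- **The kernel mean of a `Γ`-symmetric observable is the kernel mean of its orbit average.** [folklore] -/
theorem kerE_eq_kerE_orbitSum_div (β : ℝ) (γ : ι → LGConfig 4 G → LGConfig 4 G) {F : LGConfig 4 G → ℝ}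
    (hFγ : ∀ i, Continuous (F ∘ γ i)) (hsymm : ∀ i, kerE G r β c b η (F ∘ γ i) = kerE G r β c b η F) :
    kerE G r β c b η F = kerE G r β c b η (fun U => ∑ i, (F ∘ γ i) U) / Fintype.card ι := by
  have hk : (0 : ℝ) < Fintype.card ι := Nat.cast_pos.2 Fintype.card_pos
  rw [kerE_fintype_sum r c b η β (fun i => F ∘ γ i) hFγ]
  simp only [hsymm, Finset.sum_const, Finset.card_univ, nsmul_eq_mul]
  field_simp

end Algebra

/-! ## §2 Negative floors: an upper bound on the zero-temperature covariance from EACH ground state's orbit statistics -/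

section Negative

variable (c : Fin 4 → ℤ) (b : ℕ) (η : LGConfig 4 G) {ι : Type} [Fintype ι] [Nonempty ι]

/-- **Weight-free negative orbit floor.**  Let `γ` be a finite non-empty family of continuous maps leaving the cube kernel of `η` invariant on continuous
observables.  If on EVERY ground state `U` the orbit covariance of `(dens_x, dens_y)` over the orbit of `U` is `≤ −c₀` and both orbit means are within
`ρ` of a common value `t₀`, then for every `ε > 0`, eventually in `β`, `kerCov^η_β(dens_x, dens_y) ≤ −c₀ + 2ρ² + ε`.  No hypothesis relates different
ground states to each other. [folklore] -/
theorem eventually_kerCov_le_of_orbitCov_le (γ : ι → LGConfig 4 G → LGConfig 4 G) (hγ : ∀ i, Continuous (γ i))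
    (hsymm : ∀ (β : ℝ) (i : ι) (F : LGConfig 4 G → ℝ), Continuous F → kerE G r β c b η (F ∘ γ i) = kerE G r β c b η F)
    {x y : Fin 4 → ℤ} {c₀ ρ t₀ : ℝ}
    (hcov : ∀ ζ ∈ cubeMinimisers G r c b η,
      (∑ i, dens G r x (γ i (glueWith (cubeEdges c b) ζ η)) * dens G r y (γ i (glueWith (cubeEdges c b) ζ η))) / Fintype.card ι -
        (∑ i, dens G r x (γ i (glueWith (cubeEdges c b) ζ η))) / Fintype.card ι *
          ((∑ i, dens G r y (γ i (glueWith (cubeEdges c b) ζ η))) / Fintype.card ι) ≤ -c₀)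
    (hmx : ∀ ζ ∈ cubeMinimisers G r c b η, |(∑ i, dens G r x (γ i (glueWith (cubeEdges c b) ζ η))) / Fintype.card ι - t₀| ≤ ρ)
    (hmy : ∀ ζ ∈ cubeMinimisers G r c b η, |(∑ i, dens G r y (γ i (glueWith (cubeEdges c b) ζ η))) / Fintype.card ι - t₀| ≤ ρ)
    {ε : ℝ} (hε : 0 < ε) :
    ∀ᶠ β : ℝ in atTop, kerCov G r β c b η (dens G r x) (dens G r y) ≤ -c₀ + 2 * ρ ^ 2 + ε := by
  have hk : (0 : ℝ) < Fintype.card ι := Nat.cast_pos.2 Fintype.card_pos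
  have hρ : 0 ≤ ρ := by
    obtain ⟨ζ, hζ⟩ := cubeMinimisers_nonempty (G := G) (r := r) c b η
    exact (abs_nonneg _).trans (hmx ζ hζ)
  -- ε' with ε' + (2ρ + ε')ε' ≤ ε
  set ε' : ℝ := min 1 (ε / (2 + 2 * ρ)) with hε'def
  have hε' : 0 < ε' := lt_min one_pos (div_pos hε (by positivity))
  have hε'1 : ε' ≤ 1 := min_le_left _ _
  have hε'2 : ε' * (2 + 2 * ρ) ≤ ε := by
    have := min_le_right 1 (ε / (2 + 2 * ρ))
    rw [hε'def.symm] at this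
    calc ε' * (2 + 2 * ρ) ≤ ε / (2 + 2 * ρ) * (2 + 2 * ρ) := by gcongr
      _ = ε := div_mul_cancel₀ ε (by positivity)
  -- the shifted product and its orbit sum
  set Gt : LGConfig 4 G → ℝ := fun U => (dens G r x U - t₀) * (dens G r y U - t₀) with hGt
  have hGc : Continuous Gt := ((continuous_dens r x).sub continuous_const).mul ((continuous_dens r y).sub continuous_const)
  have hbound : ∀ ζ ∈ cubeMinimisers G r c b η, ∑ i, Gt (γ i (glueWith (cubeEdges c b) ζ η)) ≤ Fintype.card ι * (-c₀ + ρ ^ 2) := by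
    intro ζ hζ
    have havg := orbitAvg_shifted_mul (fun i => dens G r x (γ i (glueWith (cubeEdges c b) ζ η)))
      (fun i => dens G r y (γ i (glueWith (cubeEdges c b) ζ η))) t₀
    have hprod : ((∑ i, dens G r x (γ i (glueWith (cubeEdges c b) ζ η))) / Fintype.card ι - t₀) *
        ((∑ i, dens G r y (γ i (glueWith (cubeEdges c b) ζ η))) / Fintype.card ι - t₀) ≤ ρ ^ 2 := by
      have h1 := hmx ζ hζ; have h2 := hmy ζ hζ
      calc _ ≤ |((∑ i, dens G r x (γ i (glueWith (cubeEdges c b) ζ η))) / Fintype.card ι - t₀) *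
            ((∑ i, dens G r y (γ i (glueWith (cubeEdges c b) ζ η))) / Fintype.card ι - t₀)| := le_abs_self _
        _ = _ := abs_mul _ _
        _ ≤ ρ * ρ := mul_le_mul h1 h2 (abs_nonneg _) hρ
        _ = ρ ^ 2 := (sq ρ).symm
    have hle : (∑ i, Gt (γ i (glueWith (cubeEdges c b) ζ η))) / Fintype.card ι ≤ -c₀ + ρ ^ 2 := by
      simp only [hGt]
      rw [havg]
      linarith [hcov ζ hζ]
    rwa [div_le_iff₀ hk, mul_comm] at hle
  -- Laplace, upper, for the orbit sum of `Gt`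
  haveI : SecondCountableTopology G := (Continuous.isClosedEmbedding r.continuous r.injective).isEmbedding.secondCountableTopology
  have hLap := kerE_eventually_le (G := G) (r := r) c b η (F := fun U => ∑ i, (Gt ∘ γ i) U)
    (continuous_finsetSum Finset.univ fun i _ => hGc.comp (hγ i)) (t := Fintype.card ι * (-c₀ + ρ ^ 2))
    (fun ζ hζ => by simpa only [Function.comp_apply] using hbound ζ hζ) (mul_pos hk hε')
  -- the two kernel means
  have hX := eventually_abs_kerE_sub_orbitMean_le r c b η γ (fun i => (continuous_dens r x).comp (hγ i)) (M := Fintype.card ι * t₀)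
    (Δ := Fintype.card ι * ρ) (fun ζ hζ => abs_sub_mul_le_of_abs_div_sub_le hk (hmx ζ hζ))
    (fun β i => hsymm β i _ (continuous_dens r x)) hε'
  have hY := eventually_abs_kerE_sub_orbitMean_le r c b η γ (fun i => (continuous_dens r y).comp (hγ i)) (M := Fintype.card ι * t₀)
    (Δ := Fintype.card ι * ρ) (fun ζ hζ => abs_sub_mul_le_of_abs_div_sub_le hk (hmy ζ hζ))
    (fun β i => hsymm β i _ (continuous_dens r y)) hε'
  filter_upwards [hLap, hX, hY] with β hL hXβ hYβ
  have e1 : (Fintype.card ι : ℝ) * t₀ / Fintype.card ι = t₀ := by field_simp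
  have e2 : (Fintype.card ι : ℝ) * ρ / Fintype.card ι = ρ := by field_simp
  rw [e1, e2] at hXβ hYβ
  -- kerE Gt ≤ -c₀ + ρ² + ε'
  have hG : kerE G r β c b η Gt ≤ -c₀ + ρ ^ 2 + ε' := by
    rw [kerE_eq_kerE_orbitSum_div r c b η β γ (fun i => hGc.comp (hγ i)) (fun i => hsymm β i _ hGc), div_le_iff₀ hk]
    calc kerE G r β c b η (fun U => ∑ i, (Gt ∘ γ i) U) ≤ Fintype.card ι * (-c₀ + ρ ^ 2) + Fintype.card ι * ε' := hL
      _ = (-c₀ + ρ ^ 2 + ε') * Fintype.card ι := by ring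
  -- kerCov = kerE Gt − (m_x − t₀)(m_y − t₀)
  have eq : kerCov G r β c b η (dens G r x) (dens G r y) =
      kerE G r β c b η Gt - (kerE G r β c b η (dens G r x) - t₀) * (kerE G r β c b η (dens G r y) - t₀) := by
    simp only [hGt]
    rw [kerE_shiftedMul_eq]
    unfold kerCov
    ring
  have hprod : -((kerE G r β c b η (dens G r x) - t₀) * (kerE G r β c b η (dens G r y) - t₀)) ≤ (ρ + ε') ^ 2 := by
    calc -((kerE G r β c b η (dens G r x) - t₀) * (kerE G r β c b η (dens G r y) - t₀))
        ≤ |(kerE G r β c b η (dens G r x) - t₀) * (kerE G r β c b η (dens G r y) - t₀)| := neg_le_abs _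
      _ = |kerE G r β c b η (dens G r x) - t₀| * |kerE G r β c b η (dens G r y) - t₀| := abs_mul _ _
      _ ≤ (ρ + ε') * (ρ + ε') := mul_le_mul hXβ hYβ (abs_nonneg _) (by positivity)
      _ = (ρ + ε') ^ 2 := (sq _).symm
  rw [eq]
  nlinarith [hG, hprod, hε'1, hε'2, hε', hρ]

end Negative

/-! ## §3 Positive floors: a lower bound, uniformly over the unknown orbit weights (finite net in the shift) -/

section Positive

variable (c : Fin 4 → ℤ) (b : ℕ) (η : LGConfig 4 G) {ι : Type} [Fintype ι] [Nonempty ι]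

/-- A finite net of mesh `h > 0` on `[−R, R]`: every `m ∈ [−R, R]` is within `h` of `−R + i·h` for some `i ≤ ⌈2R/h⌉₊`. [folklore] -/
theorem exists_net_point {R h m : ℝ} (hh : 0 < h) (hm1 : -R ≤ m) (hm2 : m ≤ R) :
    ∃ i ∈ Finset.range (⌈2 * R / h⌉₊ + 1), |m - (-R + i * h)| ≤ h := by
  refine ⟨⌊(m + R) / h⌋₊, ?_, ?_⟩
  · rw [Finset.mem_range, Nat.lt_add_one_iff]
    exact Nat.floor_le_ceil _ |>.trans (Nat.ceil_mono (by rw [div_le_div_iff_of_pos_right hh]; linarith))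
  · have h0 : 0 ≤ (m + R) / h := div_nonneg (by linarith) hh.le
    have h1 := Nat.floor_le h0
    have h2 := Nat.lt_floor_add_one ((m + R) / h)
    rw [abs_le]
    constructor
    · have : (⌊(m + R) / h⌋₊ : ℝ) * h ≤ m + R := by rwa [← le_div_iff₀ hh]
      linarith
    · have : m + R < (⌊(m + R) / h⌋₊ + 1 : ℝ) * h := by rwa [← div_lt_iff₀ hh]
      nlinarith

/-- **Weight-free positive orbit floor.**  Let `γ` be a finite non-empty family of continuous maps leaving the cube kernel of `η` invariant on continuous
observables.  If on EVERY ground state `U` the orbit covariance of `(dens_x, dens_y)` over the orbit of `U` is `≥ c₀` and the two orbit means differ by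
at most `μ`, then for every `ε > 0`, eventually in `β`, `kerCov^η_β(dens_x, dens_y) ≥ c₀ − μ²/4 − ε` — uniformly over however the zero-temperature law
weighs the orbits. [folklore] -/
theorem eventually_kerCov_ge_of_orbitCov_ge (γ : ι → LGConfig 4 G → LGConfig 4 G) (hγ : ∀ i, Continuous (γ i))
    (hsymm : ∀ (β : ℝ) (i : ι) (F : LGConfig 4 G → ℝ), Continuous F → kerE G r β c b η (F ∘ γ i) = kerE G r β c b η F)
    {x y : Fin 4 → ℤ} {c₀ μ : ℝ}
    (hcov : ∀ ζ ∈ cubeMinimisers G r c b η,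
      c₀ ≤ (∑ i, dens G r x (γ i (glueWith (cubeEdges c b) ζ η)) * dens G r y (γ i (glueWith (cubeEdges c b) ζ η))) / Fintype.card ι -
        (∑ i, dens G r x (γ i (glueWith (cubeEdges c b) ζ η))) / Fintype.card ι *
          ((∑ i, dens G r y (γ i (glueWith (cubeEdges c b) ζ η))) / Fintype.card ι))
    (hmm : ∀ ζ ∈ cubeMinimisers G r c b η,
      |(∑ i, dens G r x (γ i (glueWith (cubeEdges c b) ζ η))) / Fintype.card ι -
        (∑ i, dens G r y (γ i (glueWith (cubeEdges c b) ζ η))) / Fintype.card ι| ≤ μ)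
    {ε : ℝ} (hε : 0 < ε) :
    ∀ᶠ β : ℝ in atTop, c₀ - μ ^ 2 / 4 - ε ≤ kerCov G r β c b η (dens G r x) (dens G r y) := by
  have hk : (0 : ℝ) < Fintype.card ι := Nat.cast_pos.2 Fintype.card_pos
  haveI : SecondCountableTopology G := (Continuous.isClosedEmbedding r.continuous r.injective).isEmbedding.secondCountableTopology
  -- mesh `h` with h² = ε/2
  set h : ℝ := Real.sqrt (ε / 2) with hhdef
  have hh : 0 < h := Real.sqrt_pos.2 (half_pos hε)
  have hh2 : h ^ 2 = ε / 2 := Real.sq_sqrt (half_pos hε).le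
  set R : ℝ := 6 * r.N with hR
  set net : Finset ℕ := Finset.range (⌈2 * R / h⌉₊ + 1) with hnet
  -- for each shift `t`: eventually kerE G_t ≥ c₀ − μ²/4 − ε/2
  have hshift : ∀ t : ℝ, ∀ᶠ β : ℝ in atTop,
      c₀ - μ ^ 2 / 4 - ε / 2 ≤ kerE G r β c b η (fun U => (dens G r x U - t) * (dens G r y U - t)) := by
    intro t
    set Gt : LGConfig 4 G → ℝ := fun U => (dens G r x U - t) * (dens G r y U - t) with hGt
    have hGc : Continuous Gt := ((continuous_dens r x).sub continuous_const).mul ((continuous_dens r y).sub continuous_const)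
    have hbound : ∀ ζ ∈ cubeMinimisers G r c b η, Fintype.card ι * (c₀ - μ ^ 2 / 4) ≤ ∑ i, Gt (γ i (glueWith (cubeEdges c b) ζ η)) := by
      intro ζ hζ
      have havg := orbitAvg_shifted_mul (fun i => dens G r x (γ i (glueWith (cubeEdges c b) ζ η)))
        (fun i => dens G r y (γ i (glueWith (cubeEdges c b) ζ η))) t
      set a := (∑ i, dens G r x (γ i (glueWith (cubeEdges c b) ζ η))) / Fintype.card ι with ha
      set b' := (∑ i, dens G r y (γ i (glueWith (cubeEdges c b) ζ η))) / Fintype.card ι with hb'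
      have hprod : -(μ ^ 2 / 4) ≤ (a - t) * (b' - t) := by
        have h1 : |a - b'| ≤ μ := hmm ζ hζ
        have e : (a - t) * (b' - t) = (t - (a + b') / 2) ^ 2 - ((a - b') / 2) ^ 2 := by ring
        rw [e]
        have h3 : ((a - b') / 2) ^ 2 ≤ μ ^ 2 / 4 := by
          have h4 : |(a - b') / 2| ≤ μ / 2 := by rw [abs_div, abs_two]; linarith
          have h5 : ((a - b') / 2) ^ 2 = |(a - b') / 2| ^ 2 := (sq_abs _).symm
          rw [h5]
          nlinarith [abs_nonneg ((a - b') / 2)]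
        nlinarith [sq_nonneg (t - (a + b') / 2)]
      have hge : c₀ - μ ^ 2 / 4 ≤ (∑ i, Gt (γ i (glueWith (cubeEdges c b) ζ η))) / Fintype.card ι := by
        simp only [hGt]
        rw [havg]
        linarith [hcov ζ hζ]
      rwa [le_div_iff₀ hk, mul_comm] at hge
    have hLap := kerE_eventually_ge (G := G) (r := r) c b η (F := fun U => ∑ i, (Gt ∘ γ i) U)
      (continuous_finsetSum Finset.univ fun i _ => hGc.comp (hγ i)) (t := Fintype.card ι * (c₀ - μ ^ 2 / 4))
      (fun ζ hζ => by simpa only [Function.comp_apply] using hbound ζ hζ) (mul_pos hk (half_pos hε))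
    filter_upwards [hLap] with β hL
    rw [kerE_eq_kerE_orbitSum_div r c b η β γ (fun i => hGc.comp (hγ i)) (fun i => hsymm β i _ hGc), le_div_iff₀ hk]
    calc (c₀ - μ ^ 2 / 4 - ε / 2) * Fintype.card ι = Fintype.card ι * (c₀ - μ ^ 2 / 4) - Fintype.card ι * (ε / 2) := by ring
      _ ≤ kerE G r β c b η (fun U => ∑ i, (Gt ∘ γ i) U) := hL
  -- eventually, simultaneously for every shift in the net
  have hall : ∀ᶠ β : ℝ in atTop, ∀ i ∈ net,
      c₀ - μ ^ 2 / 4 - ε / 2 ≤ kerE G r β c b η (fun U => (dens G r x U - (-R + i * h)) * (dens G r y U - (-R + i * h))) :=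
    (Filter.eventually_all_finset net).2 fun i _ => hshift (-R + i * h)
  filter_upwards [hall] with β hβ
  -- the mean shift m̄ = (m_x + m_y)/2 lies in [−R, R]
  set mx := kerE G r β c b η (dens G r x) with hmx
  set my := kerE G r β c b η (dens G r y) with hmy
  have bx : |mx| ≤ R := BoundaryLaw.abs_kerE_le G r β c b η (CornerPrice.abs_dens_le G r x)
  have bY : |my| ≤ R := BoundaryLaw.abs_kerE_le G r β c b η (CornerPrice.abs_dens_le G r y)
  rw [abs_le] at bx bY
  obtain ⟨i, hi, hnear⟩ := exists_net_point (R := R) (m := (mx + my) / 2) hh (by linarith) (by linarith)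
  have hGi := hβ i hi
  set t := -R + (i : ℝ) * h with ht
  -- kerCov = kerE G_t − (m_x − t)(m_y − t) ≥ kerE G_t − (t − m̄)²
  have eq : kerCov G r β c b η (dens G r x) (dens G r y) =
      kerE G r β c b η (fun U => (dens G r x U - t) * (dens G r y U - t)) - (t - (mx + my) / 2) ^ 2 + ((mx - my) / 2) ^ 2 := by
    rw [kerE_shiftedMul_eq]
    unfold kerCov
    ring
  rw [eq]
  have hsq : (t - (mx + my) / 2) ^ 2 ≤ h ^ 2 := by
    rw [abs_sub_comm] at hnear
    have : (t - (mx + my) / 2) ^ 2 = |t - (mx + my) / 2| ^ 2 := (sq_abs _).symm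
    rw [this]
    exact pow_le_pow_left₀ (abs_nonneg _) hnear 2
  nlinarith [hGi, hsq, hh2, sq_nonneg ((mx - my) / 2)]

end Positive

end Summit.QuantumFields.YangMills.Cruxes.NT.ClassicalShadow

end
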